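import Summits.AtomisticToContinuum.HydrodynamicLimit.Theses.JParityClosure
import Literature.Analysis.FluidPDE.CollisionWeakForm
import Literature.MathematicalPhysics.KineticTheory.CollisionTubeFunctional
import Literature.MathematicalPhysics.KineticTheory.HardSphereEulerProofs
import Summits.AtomisticToContinuum.HydrodynamicLimit.Theorems.JParityClosureOddContactSymmetryTubeStatRegular
import Summits.AtomisticToContinuum.HydrodynamicLimit.Theorems.JParityClosureOddContactSymmetryL2ToProbability
import Summits.AtomisticToContinuum.HydrodynamicLimit.Theorems.JParityClosureOddContactSymmetryStaticTubeParity

/-!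
# Line `equilibrium-rung-mean-variance` for crux `JParityClosure.OddContactSymmetry` (stmt-AtomisticToContinuum-13078)

Skeleton (crux-plan, planner-cruxplan-stmt-AtomisticToContinuum-13078-equilibrium-rung-mea-0, 2026-08-15).
Idea card `Cruxes/OddContactSymmetry/Ideas/equilibrium-rung-mean-variance.md` (ideator 1, round 1; triage r1-1: pass,
two sharpenings answered in `Lines/equilibrium-rung-mean-variance.md`).  Direction: POSITIVE — the composition
`OddContactSymmetry_of` concludes the crux decl `Summit.AtomisticToContinuum.HydrodynamicLimit.Theses.JParityClosure.
OddContactSymmetry` BY NAME from the five registered stubs (sorry-free; the stubs carry the only `sorry`s of the file).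

THE LINE.  Write `D = K_N[χ g Ψ (1+e^{−F})]` for the crux statistic (`oddStat`, the crux's `let`-chain verbatim;
`oddContactSymmetry_iff` is the `Iff.rfl` bridge).  (1) Truncate the reweighting at a level `L`
(`oddStatTrunc`, `stub_reweightingTight`: `D − D_L → 0` in probability, `L → ∞` after `N → ∞` at fixed `(r, ϑ)`).
(2) Pull every long-flight collision back along the exact pair free flight: the collision of `(i,j)` at time `s` with
normal `n̂` and pre-velocities `(v,w)` is, at every time `t ∈ [s − τ₂, s)`, the pair at relative position
`ε n̂ + (s−t)(w − v)` with the same velocities — so `D_L = ∫₀^τ A_t(Φ_t z) dt +` (short flights, time-boundary and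
continuity corrections), where `A_t = tubeStat … t` is an explicit bounded functional of the configuration at ONE time
(ordered pairs whose free flight reaches contact within the flight-time window `τ₂ = κ·ε`, quadratic-formula hitting
time, predicted normal, mark evaluated at the predicted collision, reweighting `min(1+e^{−F̃}, L)` read off the current
mollified empirical law), weight `((N+1)κ)⁻¹` so that each collision integrates to the crux's `ε/(N+1)`
(`tubeTimeStat`, `stub_cylinderPullback`: `D_L − T_{L,κ} → 0` in probability, `κ → 0` after `N → ∞`).
(3) Split `T_{L,κ} → 0` into MEAN and FLUCTUATION about the evolved law `μ_t = (Φ_t)_# LG₀` at FIXED times: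
`stub_meanParity` (MP, the parity content of the crux and the HARDEST stub: the time-integrated mean
`∫₀^τ E_{LG}[A_t ∘ Φ_t] dt → 0` for J-odd marks — the BBGKY/`f₂`-level form of `γ_a = 0`), `stub_fixedTimeVariance`
(FV, parity-free: `sup_{t ≤ τ} Var_{LG}(A_t ∘ Φ_t) → 0` — two-pair decorrelation of `μ_t` at tube resolution), and
the finite-`N` Minkowski–Chebyshev inequality `stub_l2ToProbability` (L2P, provable now:
`‖∫₀^τ (A_t − E A_t) dt‖_{L²} ≤ ∫₀^τ √Var(A_t) dt` — no dynamics, no stationarity, no mixing).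
(4) `OddContactSymmetry_of : Stubs.stub_reweightingTight → Stubs.stub_cylinderPullback → Stubs.stub_meanParity →
Stubs.stub_fixedTimeVariance → Stubs.stub_l2ToProbability → OddContactSymmetry` (the five statement `Prop`s, named like the
registered stubs so that the layer-invariant audit admits them by name; sorry-free): `η₀, σ₀, r₀ := min`, `L := max L₀ 1`,
`κ := min (κ₀/2) 1`, `N₀ := max`, and the union bound `{η < |D|} ⊆ {η/3 < |D − D_L|} ∪ {η/3 < |D_L − T|} ∪ {η/3 < |T|}`
with Chebyshev constants `m = η/6`, `ς = (δ/3)(η/6)²/τ²`.  (5) `OddContactSymmetry_proof : OddContactSymmetry :=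
OddContactSymmetry_of stub_reweightingTight … stub_l2ToProbability` — the D-0027 §3.3 shape: the registered `stub_*`
theorems (same text as the `Prop`s, `sorry` bodies) are its only gaps (`#h21_check_skeleton`: ok, theorem = `_proof`).

STATUS (lead r-0, 2026-08-16T02:15Z).  S5 `stub_l2ToProbability` and S6 `stub_tubeStatRegular` are CLOSED by tree theorems
(p74946, p74720); the rung-0 parity lemma is in the tree too (p74930, `stub_staticTubeParity`).  S1 `stub_reweightingTight` is
FALSE at the level of kinetic-theory evidence — and so is the crux AS FILED: the untruncated reweighting `1 + e^{−F}` is not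
tight (velocity-hole collisions of the fastest particles, already at global equilibrium; `Cruxes/OddContactSymmetry/
BlowupAnalysis.md`, `BlowupNumericsLite.md`, `Lines/equilibrium-rung-mean-variance-dead.md`).  The repaired crux C′
(`Cruxes/OddContactSymmetry/Repair.lean`: compactly velocity-supported marks) inherits S2–S6 verbatim (they are statements about
the truncated / tube objects); this skeleton is kept as the transfer vehicle for C′.

LEAD RESHAPE v2 (re-seated lead prover-line-stmt-AtomisticToContinuum-13078-r-0, 2026-08-16).  S5 is now PURE
finite-`N` probability (Cauchy–Schwarz in time + Chebyshev; hypotheses: the law is a probability measure, the tube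
functional is jointly measurable and uniformly bounded on `[0, τ] × Config`), and the regularity it consumes is the
new elementary stub S6 `stub_tubeStatRegular` (joint Borel measurability of `(t, z) ↦ A_t(z)` and the sup bound);
`OddContactSymmetry_of` takes SIX stub `Prop`s, caps `σ₀ ≤ 1/2` and gets the probability instance from
`isProbabilityMeasure_localGibbsLaw` (extra import `HardSphereEulerProofs`).  S1–S4 are registered verbatim as before.

VOCABULARY NOTE (lead reshape v1, 2026-08-16).  `oddStat`, `oddStatTrunc`, `tubeStat`, `tubeTimeStat` are now the TREE
definitions of `Literature.MathematicalPhysics.KineticTheory.CollisionTubeFunctional` (defn-CollisionTubeFunctional landed;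
bodies verbatim the planner's local ones, which are deleted here), so stubs proved in `Theorems/` files
(`propose --supports stmt-AtomisticToContinuum-13078`) state the registered signatures over importable vocabulary.

RUNG 0 (the card's closed special case, the lead's first milestone; NOT a separate stub because it is an instance, not a
lemma, of the line; its key static lemma `staticTubeParity` — FirstLemmaC generalised to any collision-invariant velocity
weight — and `tube_radius_J_invariant` are PROVED in this file, sorry-free): for CONSTANT profiles `(a₀, u₀, θ₀)` the local Gibbs law is the canonical Gibbs law, invariant under
every `Φ_t` (`HardSphereFlow.measurePreserving` + energy/exclusion invariance), so MP₀ and FV₀ are STATIC statements about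
the Gibbs measure: MP₀ by the static tube-parity identity (ideator's `FirstLemmaC_equilibriumTubeParity`: radial pair
correlation × Maxwellian product × J-invariant tube geometry `‖−εn̂ + τ′(w′−v′)‖ = ‖εn̂ + τ′(w−v)‖`, triage Check.lean
`tube_radius_J_invariant`) PLUS the r-ball LLN for `hm` (triage sharpening 1: at finite `N` the mean is
`−(∫χ)·ν(Ψ g sinh F) ≠ 0`; it vanishes as `N → ∞` at fixed `(r,ϑ)`, not by parity alone); FV₀ by low-density cluster
bounds (`Var_G(A) = O(L²σ³/(κN))`); PB₀/Tight₀ by Palm counts of third bodies within reach and the static LLN.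

Disproof.lean: NONE published for this crux at planning time (`ledger crux ls stmt-AtomisticToContinuum-13078`: Ideas +
TRIAGE-r1-1 only; payload `disproof_path` does not exist) — no `_false_without_<H>` theorem to honour, no landed
`Theorems/OddContactSymmetry/Negative/*` to import; dead_lines = [].  Negatives index (`ledger negatives --problem
AtomisticToContinuum`): no stub restates 9168 (∀-solution frame), 9236/9238 (small-cell degeneracy: here N → ∞ before
r, κ → 0), 14607 (cubic exponential currency: unused).  Every stub is tied to the local Gibbs data and keeps the crux's
frame (`∃ η₀ … ∃ σ₀ … ∃ r₀ … ∃ N₀`), so each is WEAKER than a frame-free analogue.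
-/

set_option linter.dupNamespace false
set_option linter.unusedVariables false

namespace Summit.AtomisticToContinuum.HydrodynamicLimit.Cruxes.OddContactSymmetry.EquilibriumRungMeanVariance

open Summit.AtomisticToContinuum.HydrodynamicLimit.Theses.JParityClosure
open scoped BigOperators Topology Classical MeasureTheory ProbabilityTheory InnerProductSpace
open Filter Set Function MeasureTheory
open Literature.Analysis.FluidPDE Literature.MathematicalPhysics.KineticTheory

noncomputable section

/-! ## Vocabulary

`oddStat`, `oddStatTrunc`, `tubeStat`, `tubeTimeStat` are the TREE definitions of
`Literature/MathematicalPhysics/KineticTheory/CollisionTubeFunctional.lean` (definition item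
`defn-CollisionTubeFunctional`, landed 2026-08-16; bodies verbatim the former local definitions of this
skeleton), opened through `open Literature.MathematicalPhysics.KineticTheory` above — so a stub proved in a
`Theorems/` file against the tree vocabulary proves the registered signature literally. -/

/-- Definitional bridge (checked by `Iff.rfl`): `OddContactSymmetry` with its `let`-chain named `oddStat`.
[folklore] -/
theorem oddContactSymmetry_iff :
    OddContactSymmetry ↔
    ∃ η₀ : ℝ, 0 < η₀ ∧ ∀ (a₀ θ₀ : T3 → ℝ) (u₀ : T3 → V3), Continuous a₀ → Continuous θ₀ → Continuous u₀ →
      (∀ x, 0 < a₀ x) → (∀ x, 0 < θ₀ x) → ∃ σ₀ : ℝ, 0 < σ₀ ∧ ∀ σ : ℝ, 0 < σ → σ < σ₀ →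
      ∀ Φ : (N : ℕ) → HardSphereFlow (Torus.geometry (Fin 3)) (hsDiameter σ N) (N + 1),
      ∀ τ : ℝ, 0 < τ → ∀ χ : ℝ × UnitAddTorus (Fin 3) → ℝ, Continuous χ → ∀ g : ℝ → ℝ, Continuous g →
      (∀ a, η₀ ≤ a → g a = 0) →
      ∀ Ψ : EuclideanSpace ℝ (Fin 3) × EuclideanSpace ℝ (Fin 3) × EuclideanSpace ℝ (Fin 3) → ℝ, Continuous Ψ →
      (∃ C : ℝ, ∀ q, |Ψ q| ≤ C) →
      (∀ (n v w : EuclideanSpace ℝ (Fin 3)), ‖n‖ = 1 →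
        Ψ (-n, (reflectVel n (v, w)).1, (reflectVel n (v, w)).2) = -Ψ (n, v, w)) →
      ∀ η δ : ℝ, 0 < η → 0 < δ → ∃ r₀ : ℝ, 0 < r₀ ∧ ∀ r ϑ : ℝ, 0 < r → r < r₀ → 0 < ϑ → ϑ < r₀ →
      ∃ N₀ : ℕ, ∀ N : ℕ, N₀ ≤ N →
        localGibbsLaw σ a₀ u₀ θ₀ N (Φ N) {z | η < |oddStat σ N (Φ N) τ χ g Ψ r ϑ z|} ≤ ENNReal.ofReal δ :=
  Iff.rfl

/-! ## Rung 0 toolkit (PROVED): the static tube-parity identity -/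

/-- **Tube geometry is J-invariant** — now the tree lemma `Theorems.tube_radius_J_invariant`
(landed p74930, `Theorems/JParityClosureOddContactSymmetryStaticTubeParity.lean`). [folklore] -/
theorem tube_radius_J_invariant (ε τ' : ℝ) (ω : Metric.sphere (0 : V3) 1) (v w : V3) :
    ‖ε • (((-ω : Metric.sphere (0 : V3) 1)) : V3) + τ' • ((collide ω (v, w)).2 - (collide ω (v, w)).1)‖ =
      ‖ε • (ω : V3) + τ' • (w - v)‖ :=
  Summit.AtomisticToContinuum.HydrodynamicLimit.Theorems.tube_radius_J_invariant ε τ' ω v w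

/-- **Static tube-parity identity** (RUNG 0's key lemma) — now the tree lemma `Theorems.staticTubeParity` /
registered helper stub `stub_staticTubeParity` (landed p74930).  For every `ε, τ′`, radial `ρ₂`, collision-invariant
velocity weight `W` and J-odd mark `Ψ`: `∫∫∫ Ψ(ω,v,w) ρ₂(‖εω + τ′(w−v)‖) W(v,w) ((w−v)·ω)₊ dv dw dω = 0`. [folklore] -/
theorem staticTubeParity (ε τ' : ℝ) (ρ₂ : ℝ → ℝ) (W : V3 × V3 → ℝ)
    (Ψ : V3 × V3 × V3 → ℝ)
    (hW : ∀ (ω : Metric.sphere (0 : V3) 1) (p : V3 × V3), W (collide ω p) = W p)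
    (hΨ : ∀ (n v w : V3), ‖n‖ = 1 →
      Ψ (-n, (reflectVel n (v, w)).1, (reflectVel n (v, w)).2) = -Ψ (n, v, w)) :
    ∫ q : (V3 × V3) × Metric.sphere (0 : V3) 1,
        Ψ ((q.2 : V3), q.1.1, q.1.2) * ρ₂ ‖ε • (q.2 : V3) + τ' • (q.1.2 - q.1.1)‖ * W q.1 *
          hardSphereKernel (q.1.2, q.1.1) q.2
        ∂(((volume : Measure V3).prod volume).prod sphereMeasure) = 0 :=
  Summit.AtomisticToContinuum.HydrodynamicLimit.Theorems.staticTubeParity ε τ' ρ₂ W Ψ hW hΨ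

/-! ## The six registered stubs (each: the statement `Prop` `Stubs.stub_*`, then the theorem `stub_*` with the same text — sorried while open, the tree theorem once landed) -/

/-- **S1 · the reweighting is tight** (`stub_reweightingTight`; parity-free, for EVERY bounded continuous mark).
In the crux's frame (`∃ η₀`, profiles, `∃ σ₀`, any flows, `τ, χ, g, Ψ`, `∀ η δ ∃ r₀ ∀ r ϑ < r₀`) there is a truncation
level `L₀ = L₀(r, ϑ, …)` such that for `L ≥ L₀` and `N ≥ N₀(L)`:  `P(|D − D_L| > η) ≤ δ`, i.e. the collisions whose
reweighting factor `1 + e^{−F} = 1 + h(v⁺)h(w⁺)/(h(v⁻)h(w⁻))` exceeds `L` carry a vanishing share of the `K_N`-mass in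
probability (`D − D_L = K_N[χ g Ψ (1 + e^{−F} − L)₊]`).  Why plausibly true: as `N → ∞` at fixed `(r,ϑ)` the mollified
empirical law `h = hm` concentrates (r-ball law of large numbers) on a mixture of Gaussians of width `≥ ϑ` bounded below
on bounded velocities wherever the local density and kinetic energy are bounded away from `0`/`∞`; by energy
conservation in the local frame the four values of `h` at one collision are then comparable up to `exp(C|v|²)`-tails,
which `CollisionTightness` + kinetic-energy tails make negligible.  The honest a-priori input is a LOCAL lower bound
on `hm` at the pre-collisional velocities along the flow, in probability (no `r`-vacuum bubble, no ultracold spot: a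
`DensityCap`-type hypothesis of the route, here from below); at equilibrium (rung 0) it is the static LLN.  The crux as
filed needs exactly this to be tight at all (crux-attack report: "E e^{−F} may diverge on self-spike events; the
in-probability form survives"), so nothing is added to the crux's burden.  Size L.  Leans on: route supports
`CollisionTightness` (stmt-13085), `KineticEnergyTails` (13087); tree `localGibbs_lln` (t = 0 LLN pattern),
`integral_empiricalMeasure`, `IsHardSphereTrajectory.numCollisions_eq`. -/
def Stubs.stub_reweightingTight : Prop :=
    ∃ η₀ : ℝ, 0 < η₀ ∧ ∀ (a₀ θ₀ : T3 → ℝ) (u₀ : T3 → V3), Continuous a₀ → Continuous θ₀ → Continuous u₀ →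
      (∀ x, 0 < a₀ x) → (∀ x, 0 < θ₀ x) → ∃ σ₀ : ℝ, 0 < σ₀ ∧ ∀ σ : ℝ, 0 < σ → σ < σ₀ →
      ∀ Φ : (N : ℕ) → HardSphereFlow (Torus.geometry (Fin 3)) (hsDiameter σ N) (N + 1),
      ∀ τ : ℝ, 0 < τ → ∀ χ : ℝ × UnitAddTorus (Fin 3) → ℝ, Continuous χ → ∀ g : ℝ → ℝ, Continuous g →
      (∀ a, η₀ ≤ a → g a = 0) →
      ∀ Ψ : EuclideanSpace ℝ (Fin 3) × EuclideanSpace ℝ (Fin 3) × EuclideanSpace ℝ (Fin 3) → ℝ, Continuous Ψ →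
      (∃ C : ℝ, ∀ q, |Ψ q| ≤ C) →
      ∀ η δ : ℝ, 0 < η → 0 < δ → ∃ r₀ : ℝ, 0 < r₀ ∧ ∀ r ϑ : ℝ, 0 < r → r < r₀ → 0 < ϑ → ϑ < r₀ →
      ∃ L₀ : ℝ, ∀ L : ℝ, L₀ ≤ L → ∃ N₀ : ℕ, ∀ N : ℕ, N₀ ≤ N →
        localGibbsLaw σ a₀ u₀ θ₀ N (Φ N)
          {z | η < |oddStat σ N (Φ N) τ χ g Ψ r ϑ z - oddStatTrunc σ N (Φ N) τ χ g Ψ r ϑ L z|}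
          ≤ ENNReal.ofReal δ

/-- Registered stub S1 (`Stubs.stub_reweightingTight`, verbatim): the `sorry` to be discharged. -/
theorem stub_reweightingTight :
    ∃ η₀ : ℝ, 0 < η₀ ∧ ∀ (a₀ θ₀ : T3 → ℝ) (u₀ : T3 → V3), Continuous a₀ → Continuous θ₀ → Continuous u₀ →
      (∀ x, 0 < a₀ x) → (∀ x, 0 < θ₀ x) → ∃ σ₀ : ℝ, 0 < σ₀ ∧ ∀ σ : ℝ, 0 < σ → σ < σ₀ →
      ∀ Φ : (N : ℕ) → HardSphereFlow (Torus.geometry (Fin 3)) (hsDiameter σ N) (N + 1),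
      ∀ τ : ℝ, 0 < τ → ∀ χ : ℝ × UnitAddTorus (Fin 3) → ℝ, Continuous χ → ∀ g : ℝ → ℝ, Continuous g →
      (∀ a, η₀ ≤ a → g a = 0) →
      ∀ Ψ : EuclideanSpace ℝ (Fin 3) × EuclideanSpace ℝ (Fin 3) × EuclideanSpace ℝ (Fin 3) → ℝ, Continuous Ψ →
      (∃ C : ℝ, ∀ q, |Ψ q| ≤ C) →
      ∀ η δ : ℝ, 0 < η → 0 < δ → ∃ r₀ : ℝ, 0 < r₀ ∧ ∀ r ϑ : ℝ, 0 < r → r < r₀ → 0 < ϑ → ϑ < r₀ →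
      ∃ L₀ : ℝ, ∀ L : ℝ, L₀ ≤ L → ∃ N₀ : ℕ, ∀ N : ℕ, N₀ ≤ N →
        localGibbsLaw σ a₀ u₀ θ₀ N (Φ N)
          {z | η < |oddStat σ N (Φ N) τ χ g Ψ r ϑ z - oddStatTrunc σ N (Φ N) τ χ g Ψ r ϑ L z|}
          ≤ ENNReal.ofReal δ := by
  sorry

/-- **S2 · the cylinder pull-back in probability** (`stub_cylinderPullback`; parity-free, deterministic bookkeeping
plus a short-flight count).  Same frame; for every truncation level `L ≥ 1` there is a flight-time parameter
`κ₀ = κ₀(L, r, ϑ, …) > 0` such that for `0 < κ < κ₀` and `N ≥ N₀(κ)`:  `P(|D_L − T_{L,κ}| > η) ≤ δ`.  Why plausibly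
true: on the good set every collision at time `s` whose two partners flew freely during `[s − τ₂, s]` (`τ₂ = κε`) is
seen by `A_t` for exactly `t ∈ [s − τ₂, s)` with the correct `(n̂, v⁻, w⁻)` (free flight: `q(t) = εn̂ + (s−t)(w−v)`,
quadratic hitting time, `G.sepVec` of translated points on `𝕋³` for `‖q‖ ≪ 1/2`), hence contributes
`τ₂ · ((N+1)κ)⁻¹ = ε/(N+1)` times its mark — the PATHWISE identity `D_L = T_{L,κ} + R_κ + B + C` with: `R_κ` the short
flights (a third body hits `i` or `j` within `τ₂` of the collision, or a tube pair is intercepted: a fraction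
`O(κ · σ³ρ_loc)` of the `K_N`-mass under the density cutoff `g`, in probability, by a Palm-type count of third bodies
within reach — `CollisionTightness`-level input), `B` the time boundary (`s < τ₂` or tube pairs at `t > τ − τ₂`:
fraction `τ₂/τ → 0`), `C` the continuity corrections (`χ, g∘ρ_r, hm` read at time `t` and position `x_i(t)` instead of
`s, x_i(s)`: displacements `≤ |v|κε`, a fraction `O(κσ³)` of velocities jump in between; `χ` uniformly continuous, `bx`
and the Gaussian `r⁻⁴`/`ϑ⁻⁴`-Lipschitz, the truncated weight `min(1+e^{−F}, L)` `L`-Lipschitz in `F` — all `→ 0` as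
`N → ∞` then `κ → 0`, given the same local lower bound on `hm` as S1).  Size M–L.  Leans on: tree
`IsHardSphereTrajectory.{free, binary, locFinite, eq_freeFlight}`, `freeFlight_apply`, `Torus.geometry_sepVec`,
`reflectVel_reflectVel`, `inner_reflectVel_fst_sub_snd`, `HardSphereFlow.{isTrajectory, mapsTo_good, flow_add}`,
`measurePreserving_restrict_good`-pattern; route supports `CollisionTightness` (13085), `EmpiricalEnskogIdentity`
(13086, same collision-sum bookkeeping); GST2013 §4, PulvirentiSimonellaTrushechkin2018 (collision histories). -/
def Stubs.stub_cylinderPullback : Prop :=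
    ∃ η₀ : ℝ, 0 < η₀ ∧ ∀ (a₀ θ₀ : T3 → ℝ) (u₀ : T3 → V3), Continuous a₀ → Continuous θ₀ → Continuous u₀ →
      (∀ x, 0 < a₀ x) → (∀ x, 0 < θ₀ x) → ∃ σ₀ : ℝ, 0 < σ₀ ∧ ∀ σ : ℝ, 0 < σ → σ < σ₀ →
      ∀ Φ : (N : ℕ) → HardSphereFlow (Torus.geometry (Fin 3)) (hsDiameter σ N) (N + 1),
      ∀ τ : ℝ, 0 < τ → ∀ χ : ℝ × UnitAddTorus (Fin 3) → ℝ, Continuous χ → ∀ g : ℝ → ℝ, Continuous g →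
      (∀ a, η₀ ≤ a → g a = 0) →
      ∀ Ψ : EuclideanSpace ℝ (Fin 3) × EuclideanSpace ℝ (Fin 3) × EuclideanSpace ℝ (Fin 3) → ℝ, Continuous Ψ →
      (∃ C : ℝ, ∀ q, |Ψ q| ≤ C) →
      ∀ η δ : ℝ, 0 < η → 0 < δ → ∃ r₀ : ℝ, 0 < r₀ ∧ ∀ r ϑ : ℝ, 0 < r → r < r₀ → 0 < ϑ → ϑ < r₀ →
      ∀ L : ℝ, 1 ≤ L → ∃ κ₀ : ℝ, 0 < κ₀ ∧ ∀ κ : ℝ, 0 < κ → κ < κ₀ → ∃ N₀ : ℕ, ∀ N : ℕ, N₀ ≤ N →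
        localGibbsLaw σ a₀ u₀ θ₀ N (Φ N)
          {z | η < |oddStatTrunc σ N (Φ N) τ χ g Ψ r ϑ L z - tubeTimeStat σ N (Φ N) τ χ g Ψ r ϑ L κ z|}
          ≤ ENNReal.ofReal δ

/-- Registered stub S2 (`Stubs.stub_cylinderPullback`, verbatim): the `sorry` to be discharged. -/
theorem stub_cylinderPullback :
    ∃ η₀ : ℝ, 0 < η₀ ∧ ∀ (a₀ θ₀ : T3 → ℝ) (u₀ : T3 → V3), Continuous a₀ → Continuous θ₀ → Continuous u₀ →
      (∀ x, 0 < a₀ x) → (∀ x, 0 < θ₀ x) → ∃ σ₀ : ℝ, 0 < σ₀ ∧ ∀ σ : ℝ, 0 < σ → σ < σ₀ →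
      ∀ Φ : (N : ℕ) → HardSphereFlow (Torus.geometry (Fin 3)) (hsDiameter σ N) (N + 1),
      ∀ τ : ℝ, 0 < τ → ∀ χ : ℝ × UnitAddTorus (Fin 3) → ℝ, Continuous χ → ∀ g : ℝ → ℝ, Continuous g →
      (∀ a, η₀ ≤ a → g a = 0) →
      ∀ Ψ : EuclideanSpace ℝ (Fin 3) × EuclideanSpace ℝ (Fin 3) × EuclideanSpace ℝ (Fin 3) → ℝ, Continuous Ψ →
      (∃ C : ℝ, ∀ q, |Ψ q| ≤ C) →
      ∀ η δ : ℝ, 0 < η → 0 < δ → ∃ r₀ : ℝ, 0 < r₀ ∧ ∀ r ϑ : ℝ, 0 < r → r < r₀ → 0 < ϑ → ϑ < r₀ →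
      ∀ L : ℝ, 1 ≤ L → ∃ κ₀ : ℝ, 0 < κ₀ ∧ ∀ κ : ℝ, 0 < κ → κ < κ₀ → ∃ N₀ : ℕ, ∀ N : ℕ, N₀ ≤ N →
        localGibbsLaw σ a₀ u₀ θ₀ N (Φ N)
          {z | η < |oddStatTrunc σ N (Φ N) τ χ g Ψ r ϑ L z - tubeTimeStat σ N (Φ N) τ χ g Ψ r ϑ L κ z|}
          ≤ ENNReal.ofReal δ := by
  sorry

/-- **S3 · MEAN PARITY** (`stub_meanParity`; THE PARITY BET — hardest, load-bearing, the only stub that uses the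
J-oddness of `Ψ`).  Same frame, J-odd bounded continuous `Ψ`: `∀ η ∃ r₀ ∀ r ϑ < r₀ ∀ L ≥ 1 ∀ κ ∈ (0,1] ∃ N₀ ∀ N ≥ N₀`,
`|∫₀^τ E_{LG}[A_t ∘ Φ_t] dt| ≤ η`: the time-integrated ensemble mean of the tube functional under the evolved
local-Gibbs law `μ_t = (Φ_t)_# LG₀` vanishes — in BBGKY form, the pre-collisional two-body function `f₂^{(N)}(t)` of
`μ_t` on the incoming tube (`|q| ≤ ε(1 + κ|v−w|)`), reweighted by `hh_* + h′h′_*` through the local one-body law, is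
J-even in the limit.  Why it might fail: this IS the crux in expectation (crux + uniform integrability ⇒ S3, so a
profile with a non-vanishing mean kills the crux outright) — ring/recollision memory or long-lived hydrodynamic modes
could sustain an `O(1)` J-odd contact correlation in forward local-Gibbs evolutions; at fixed `r` the local-equilibrium
residual `T₂(r) ∝ (r∇θ/θ)², (r∇u)²` (crux-attack toy MC) is why `r₀` comes BEFORE `N₀`; truncation at `L < 2` and long
tubes `κ ~ 1` change the weight but not the limit (local Maxwellian `h` ⇒ `F → 0` on typical collisions; density
gradients across a tube of length `κε` weigh `O(κε|∇ρ|) → 0`).  Why plausibly true: local equilibrium at the two-body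
level on microscopic scales at Euler scaling (`Kn ≍ N^{−1/3} → 0` at fixed reduced density); exactly zero for every
J-even contact structure (Enskog `Y`, position-only or `|g|,|g·n̂|`-dependent `γ`).  RUNG 0 (constant profiles):
provable now — stationarity of the Gibbs law under `Φ_t`, the static tube-parity identity (radial `ρ₂` × Maxwellians ×
J-invariant tube; ideator's `FirstLemmaC`, triage `tube_radius_J_invariant`) and the r-ball LLN for `hm` (triage
sharpening 1).  Size XL (open) in general; L at rung 0.  Leans on: tree `measurePreserving_swap_negDir`,
`measurePreserving_collideSwap_prod`, `integral_comp_swap_negDir`, `hardSphereKernel_swap_neg`, `reflectVel_eq_collide`,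
`HardSphereFlow.measurePreserving`, `localGibbs_lln`; mechanism inputs from the sibling cards
`pt-shadow-flux-detailed-balance` (R̂-reversibility of local limits) / `rate-sandwich-isolated-maxwellians`, or the
route's informal child FirstOrderOddResponse (stmt-14620, ring operator); CIP1994 §3.2, Spohn1991 I.3, GST2013. -/
def Stubs.stub_meanParity : Prop :=
    ∃ η₀ : ℝ, 0 < η₀ ∧ ∀ (a₀ θ₀ : T3 → ℝ) (u₀ : T3 → V3), Continuous a₀ → Continuous θ₀ → Continuous u₀ →
      (∀ x, 0 < a₀ x) → (∀ x, 0 < θ₀ x) → ∃ σ₀ : ℝ, 0 < σ₀ ∧ ∀ σ : ℝ, 0 < σ → σ < σ₀ →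
      ∀ Φ : (N : ℕ) → HardSphereFlow (Torus.geometry (Fin 3)) (hsDiameter σ N) (N + 1),
      ∀ τ : ℝ, 0 < τ → ∀ χ : ℝ × UnitAddTorus (Fin 3) → ℝ, Continuous χ → ∀ g : ℝ → ℝ, Continuous g →
      (∀ a, η₀ ≤ a → g a = 0) →
      ∀ Ψ : EuclideanSpace ℝ (Fin 3) × EuclideanSpace ℝ (Fin 3) × EuclideanSpace ℝ (Fin 3) → ℝ, Continuous Ψ →
      (∃ C : ℝ, ∀ q, |Ψ q| ≤ C) →
      (∀ (n v w : EuclideanSpace ℝ (Fin 3)), ‖n‖ = 1 →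
        Ψ (-n, (reflectVel n (v, w)).1, (reflectVel n (v, w)).2) = -Ψ (n, v, w)) →
      ∀ η : ℝ, 0 < η → ∃ r₀ : ℝ, 0 < r₀ ∧ ∀ r ϑ : ℝ, 0 < r → r < r₀ → 0 < ϑ → ϑ < r₀ →
      ∀ L κ : ℝ, 1 ≤ L → 0 < κ → κ ≤ 1 → ∃ N₀ : ℕ, ∀ N : ℕ, N₀ ≤ N →
        |∫ t in Set.Icc (0 : ℝ) τ,
            ∫ z, tubeStat σ N χ g Ψ r ϑ L κ t ((Φ N).flow t z) ∂(localGibbsLaw σ a₀ u₀ θ₀ N (Φ N))| ≤ η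

/-- Registered stub S3 (`Stubs.stub_meanParity`, verbatim): the `sorry` to be discharged. -/
theorem stub_meanParity :
    ∃ η₀ : ℝ, 0 < η₀ ∧ ∀ (a₀ θ₀ : T3 → ℝ) (u₀ : T3 → V3), Continuous a₀ → Continuous θ₀ → Continuous u₀ →
      (∀ x, 0 < a₀ x) → (∀ x, 0 < θ₀ x) → ∃ σ₀ : ℝ, 0 < σ₀ ∧ ∀ σ : ℝ, 0 < σ → σ < σ₀ →
      ∀ Φ : (N : ℕ) → HardSphereFlow (Torus.geometry (Fin 3)) (hsDiameter σ N) (N + 1),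
      ∀ τ : ℝ, 0 < τ → ∀ χ : ℝ × UnitAddTorus (Fin 3) → ℝ, Continuous χ → ∀ g : ℝ → ℝ, Continuous g →
      (∀ a, η₀ ≤ a → g a = 0) →
      ∀ Ψ : EuclideanSpace ℝ (Fin 3) × EuclideanSpace ℝ (Fin 3) × EuclideanSpace ℝ (Fin 3) → ℝ, Continuous Ψ →
      (∃ C : ℝ, ∀ q, |Ψ q| ≤ C) →
      (∀ (n v w : EuclideanSpace ℝ (Fin 3)), ‖n‖ = 1 →
        Ψ (-n, (reflectVel n (v, w)).1, (reflectVel n (v, w)).2) = -Ψ (n, v, w)) →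
      ∀ η : ℝ, 0 < η → ∃ r₀ : ℝ, 0 < r₀ ∧ ∀ r ϑ : ℝ, 0 < r → r < r₀ → 0 < ϑ → ϑ < r₀ →
      ∀ L κ : ℝ, 1 ≤ L → 0 < κ → κ ≤ 1 → ∃ N₀ : ℕ, ∀ N : ℕ, N₀ ≤ N →
        |∫ t in Set.Icc (0 : ℝ) τ,
            ∫ z, tubeStat σ N χ g Ψ r ϑ L κ t ((Φ N).flow t z) ∂(localGibbsLaw σ a₀ u₀ θ₀ N (Φ N))| ≤ η := by
  sorry

/-- **S4 · FIXED-TIME VARIANCE** (`stub_fixedTimeVariance`; parity-free, for EVERY bounded continuous mark; the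
fluctuation half).  Same frame: `∀ ς > 0 ∃ r₀ ∀ r ϑ < r₀ ∀ L ≥ 1 ∀ κ ∈ (0,1] ∃ N₀ ∀ N ≥ N₀ ∀ t ∈ [0,τ]`,
`Var_{LG}(A_t ∘ Φ_t) ≤ ς` (Mathlib `ProbabilityTheory.variance`): uniformly in time, the tube functional of the
configuration at ONE time concentrates under the evolved law `μ_t`.  Scales: `~κσ³N` ordered pairs sit in the tube,
each weighted `≤ C_χ C_g C_Ψ L/((N+1)κ)`, so diagonal and one-shared-particle terms give `O(L²σ³/(κN)) → 0`, and the
statement is the RELATIVE decorrelation of two DISJOINT tube pairs under `μ_t` (a 4-body static property at tube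
resolution) plus the r-ball concentration of `ρm, hm` entering the marks.  Why it might fail / honest size: for
`t > 0` this is propagation of microscopic spatial decorrelation along the deterministic flow — parity-free but open,
plausibly as hard as fixed-time field concentration itself (triage sharpening 2); it is SHARED currency (every
concentration-based route needs fixed-time LLNs), not this line's mechanism.  RUNG 0: the Gibbs law is invariant, so
it is the static low-density cluster bound `Var_G(A) = O(L²σ³/(κN))` (tree `localGibbs_lln` machinery; Ruelle1969,
LebowitzPenrose1964).  Size XL in general; L at rung 0.  Leans on: Mathlib `ProbabilityTheory.variance`,
`IndepFun.variance_sum`-type bookkeeping, tree `integral_empiricalMeasure`, `canonicalDensity`, `particleLaw`,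
`HardSphereFlow.lawAt`; Spohn1991 I.3; OllaVaradhanYau1993 (what fixed-time LLNs cost with noise). -/
def Stubs.stub_fixedTimeVariance : Prop :=
    ∃ η₀ : ℝ, 0 < η₀ ∧ ∀ (a₀ θ₀ : T3 → ℝ) (u₀ : T3 → V3), Continuous a₀ → Continuous θ₀ → Continuous u₀ →
      (∀ x, 0 < a₀ x) → (∀ x, 0 < θ₀ x) → ∃ σ₀ : ℝ, 0 < σ₀ ∧ ∀ σ : ℝ, 0 < σ → σ < σ₀ →
      ∀ Φ : (N : ℕ) → HardSphereFlow (Torus.geometry (Fin 3)) (hsDiameter σ N) (N + 1),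
      ∀ τ : ℝ, 0 < τ → ∀ χ : ℝ × UnitAddTorus (Fin 3) → ℝ, Continuous χ → ∀ g : ℝ → ℝ, Continuous g →
      (∀ a, η₀ ≤ a → g a = 0) →
      ∀ Ψ : EuclideanSpace ℝ (Fin 3) × EuclideanSpace ℝ (Fin 3) × EuclideanSpace ℝ (Fin 3) → ℝ, Continuous Ψ →
      (∃ C : ℝ, ∀ q, |Ψ q| ≤ C) →
      ∀ ς : ℝ, 0 < ς → ∃ r₀ : ℝ, 0 < r₀ ∧ ∀ r ϑ : ℝ, 0 < r → r < r₀ → 0 < ϑ → ϑ < r₀ →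
      ∀ L κ : ℝ, 1 ≤ L → 0 < κ → κ ≤ 1 → ∃ N₀ : ℕ, ∀ N : ℕ, N₀ ≤ N → ∀ t ∈ Set.Icc (0 : ℝ) τ,
        ProbabilityTheory.variance (fun z => tubeStat σ N χ g Ψ r ϑ L κ t ((Φ N).flow t z))
          (localGibbsLaw σ a₀ u₀ θ₀ N (Φ N)) ≤ ς

/-- Registered stub S4 (`Stubs.stub_fixedTimeVariance`, verbatim): the `sorry` to be discharged. -/
theorem stub_fixedTimeVariance :
    ∃ η₀ : ℝ, 0 < η₀ ∧ ∀ (a₀ θ₀ : T3 → ℝ) (u₀ : T3 → V3), Continuous a₀ → Continuous θ₀ → Continuous u₀ →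
      (∀ x, 0 < a₀ x) → (∀ x, 0 < θ₀ x) → ∃ σ₀ : ℝ, 0 < σ₀ ∧ ∀ σ : ℝ, 0 < σ → σ < σ₀ →
      ∀ Φ : (N : ℕ) → HardSphereFlow (Torus.geometry (Fin 3)) (hsDiameter σ N) (N + 1),
      ∀ τ : ℝ, 0 < τ → ∀ χ : ℝ × UnitAddTorus (Fin 3) → ℝ, Continuous χ → ∀ g : ℝ → ℝ, Continuous g →
      (∀ a, η₀ ≤ a → g a = 0) →
      ∀ Ψ : EuclideanSpace ℝ (Fin 3) × EuclideanSpace ℝ (Fin 3) × EuclideanSpace ℝ (Fin 3) → ℝ, Continuous Ψ →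
      (∃ C : ℝ, ∀ q, |Ψ q| ≤ C) →
      ∀ ς : ℝ, 0 < ς → ∃ r₀ : ℝ, 0 < r₀ ∧ ∀ r ϑ : ℝ, 0 < r → r < r₀ → 0 < ϑ → ϑ < r₀ →
      ∀ L κ : ℝ, 1 ≤ L → 0 < κ → κ ≤ 1 → ∃ N₀ : ℕ, ∀ N : ℕ, N₀ ≤ N → ∀ t ∈ Set.Icc (0 : ℝ) τ,
        ProbabilityTheory.variance (fun z => tubeStat σ N χ g Ψ r ϑ L κ t ((Φ N).flow t z))
          (localGibbsLaw σ a₀ u₀ θ₀ N (Φ N)) ≤ ς := by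
  sorry

/-- **S5 · CAUCHY–SCHWARZ–CHEBYSHEV, `L² →` probability** (`stub_l2ToProbability`; the card's lever (i), a
finite-`N` inequality with NO limit, NO dynamics, NO stationarity — provable now; RESHAPED by the lead 2026-08-16 so
that it is a statement of pure finite-`N` probability: the regularity of the tube functional it consumes — joint
Borel measurability in `(t, z)` and a uniform bound on `[0, τ] × Config` — is supplied by the new stub S6
`stub_tubeStatRegular`, and the law is assumed to be a probability measure, which the composition gets from
`isProbabilityMeasure_localGibbsLaw`).  For every `σ`, profiles, `N`, flow `Φ`, `τ > 0`, marks, `r, ϑ, L, κ`,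
`ς ≥ 0`, `m < η` and bound `B`: if `P = localGibbsLaw …` is a probability measure, `(t, z) ↦ A_t(z)` is measurable
with `|A_t(z)| ≤ B` on `[0, τ] × Config`, the time-integrated mean of `A_t ∘ Φ_t` under `P` has modulus `≤ m` and
`Var_P(A_t ∘ Φ_t) ≤ ς` for every `t ∈ [0,τ]`, then `P(η < |T_{L,κ}|) ≤ τ²ς/(η − m)²`.  Proof on paper: put
`X̃(t, z) := A_t(good.piecewise Φ_t id z)`, jointly measurable by `HardSphereFlow.measurable_piecewise_flow`
(`measurable_piecewise_flow_torus`) and bounded by `B`; `P`-a.e. `z` is good (`P ≪` Liouville,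
`HardSphereFlow.ae_mem_good`), and for good `z`, `X̃(·, z) = A_·(Φ_· z)`, so means, variances, `T` and the event are
unchanged a.e.; with `e(t) := E_P X̃_t` (measurable in `t`, Fubini) and `M := ∫₀^τ e = ` the hypothesis' iterated
integral (`|M| ≤ m`, NO Fubini needed for it), pointwise `T̃(z) − M = ∫₀^τ (X̃_t(z) − e(t)) dt`, Cauchy–Schwarz in
time `|T̃(z) − M|² ≤ τ ∫₀^τ (X̃_t(z) − e(t))² dt`, Tonelli `E_P ∫₀^τ (X̃_t − e(t))² dt = ∫₀^τ Var_P(X̃_t) dt ≤ τς`,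
and Markov on the square over `{η − m ≤ |T̃ − M|} ⊇ {η < |T̃|}`.  Size M.  Leans on: Mathlib
`ProbabilityTheory.variance`, `evariance`, `meas_ge_le_variance_div_sq` / `mul_meas_ge_le_lintegral₀`,
`lintegral_lintegral_swap` / `integral_integral_swap`, `ENNReal.lintegral_mul_le_Lp_mul_Lq` (Hölder, `p = q = 2`),
`StronglyMeasurable.integral_prod_right`; tree `measurable_piecewise_flow_torus`, `piecewise_flow_of_mem`,
`HardSphereFlow.ae_mem_good`, `localGibbsLaw_eq`, `localGibbsMeasure_absolutelyContinuous`, `tubeTimeStat_def`. -/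
def Stubs.stub_l2ToProbability : Prop :=
    ∀ (σ : ℝ) (a₀ θ₀ : T3 → ℝ) (u₀ : T3 → V3) (N : ℕ)
      (Φ : HardSphereFlow (Torus.geometry (Fin 3)) (hsDiameter σ N) (N + 1))
      (τ : ℝ) (χ : ℝ × UnitAddTorus (Fin 3) → ℝ) (g : ℝ → ℝ)
      (Ψ : EuclideanSpace ℝ (Fin 3) × EuclideanSpace ℝ (Fin 3) × EuclideanSpace ℝ (Fin 3) → ℝ)
      (r ϑ L κ m ς η B : ℝ),
      IsProbabilityMeasure (localGibbsLaw σ a₀ u₀ θ₀ N Φ) →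
      Measurable (fun p : ℝ × Config (N + 1) (Fin 3) T3 => tubeStat σ N χ g Ψ r ϑ L κ p.1 p.2) →
      (∀ t ∈ Set.Icc (0 : ℝ) τ, ∀ z : Config (N + 1) (Fin 3) T3, |tubeStat σ N χ g Ψ r ϑ L κ t z| ≤ B) →
      0 < τ → 0 ≤ ς → m < η →
      |∫ t in Set.Icc (0 : ℝ) τ,
          ∫ z, tubeStat σ N χ g Ψ r ϑ L κ t (Φ.flow t z) ∂(localGibbsLaw σ a₀ u₀ θ₀ N Φ)| ≤ m →
      (∀ t ∈ Set.Icc (0 : ℝ) τ,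
        ProbabilityTheory.variance (fun z => tubeStat σ N χ g Ψ r ϑ L κ t (Φ.flow t z))
          (localGibbsLaw σ a₀ u₀ θ₀ N Φ) ≤ ς) →
      localGibbsLaw σ a₀ u₀ θ₀ N Φ {z | η < |tubeTimeStat σ N Φ τ χ g Ψ r ϑ L κ z|}
        ≤ ENNReal.ofReal (τ ^ 2 * ς / (η - m) ^ 2)

/-- Registered stub S5 (`Stubs.stub_l2ToProbability`, verbatim): CLOSED — proved in the tree by worker S5 (p74946). [folklore] -/
theorem stub_l2ToProbability :
    ∀ (σ : ℝ) (a₀ θ₀ : T3 → ℝ) (u₀ : T3 → V3) (N : ℕ)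
      (Φ : HardSphereFlow (Torus.geometry (Fin 3)) (hsDiameter σ N) (N + 1))
      (τ : ℝ) (χ : ℝ × UnitAddTorus (Fin 3) → ℝ) (g : ℝ → ℝ)
      (Ψ : EuclideanSpace ℝ (Fin 3) × EuclideanSpace ℝ (Fin 3) × EuclideanSpace ℝ (Fin 3) → ℝ)
      (r ϑ L κ m ς η B : ℝ),
      IsProbabilityMeasure (localGibbsLaw σ a₀ u₀ θ₀ N Φ) →
      Measurable (fun p : ℝ × Config (N + 1) (Fin 3) T3 => tubeStat σ N χ g Ψ r ϑ L κ p.1 p.2) →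
      (∀ t ∈ Set.Icc (0 : ℝ) τ, ∀ z : Config (N + 1) (Fin 3) T3, |tubeStat σ N χ g Ψ r ϑ L κ t z| ≤ B) →
      0 < τ → 0 ≤ ς → m < η →
      |∫ t in Set.Icc (0 : ℝ) τ,
          ∫ z, tubeStat σ N χ g Ψ r ϑ L κ t (Φ.flow t z) ∂(localGibbsLaw σ a₀ u₀ θ₀ N Φ)| ≤ m →
      (∀ t ∈ Set.Icc (0 : ℝ) τ,
        ProbabilityTheory.variance (fun z => tubeStat σ N χ g Ψ r ϑ L κ t (Φ.flow t z))
          (localGibbsLaw σ a₀ u₀ θ₀ N Φ) ≤ ς) →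
      localGibbsLaw σ a₀ u₀ θ₀ N Φ {z | η < |tubeTimeStat σ N Φ τ χ g Ψ r ϑ L κ z|}
        ≤ ENNReal.ofReal (τ ^ 2 * ς / (η - m) ^ 2) :=
  -- LANDED (worker S5, p74946): `Theorems/JParityClosureOddContactSymmetryL2ToProbability.lean`
  Summit.AtomisticToContinuum.HydrodynamicLimit.Theorems.stub_l2ToProbability

/-- **S6 · REGULARITY OF THE TUBE FUNCTIONAL** (`stub_tubeStatRegular`; NEW stub of the lead's reshape
2026-08-16, split off S5 so that S5 never unfolds `tubeStat`; elementary, provable now).  For continuous `χ, g, Ψ`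
with `Ψ` bounded, `r > 0`, `L ≥ 0`, `κ ≥ 0` and any `τ`: (i) `(t, z) ↦ A_t(z) = tubeStat σ N χ g Ψ r ϑ L κ t z` is
Borel measurable on `ℝ × Config` — a finite double sum of `if … then … else 0` over the tube predicate (a conjunction
of `<`/`≤` between continuous functions of `z`: norms, inner products, `Real.sqrt`, a division) of products of
continuous (`χ`, `g ∘` cone-mollified empirical density, `Ψ ∘` predicted normal, `localMaxwellian`, `Real.exp`) and
measurable (`Real.log`, `min`) functions, the empirical-measure integrals being finite averages
(`integral_empiricalMeasure`); (ii) `|A_t(z)| ≤ B` uniformly on `[0, τ] × Config`: `χ` is bounded on the compact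
`[0, τ] × 𝕋³`, the cone-mollified empirical density lies in `[0, 3/(π r³)]` so `g` is only evaluated on the compact
interval `σ³ · [0, 3/(π r³)]`, `|Ψ| ≤ C_Ψ`, the truncated reweighting lies in `[0, L]`, and at most `(N + 1)²`
ordered pairs carry the weight `((N+1)κ)⁻¹ ≥ 0` (cf. `abs_tubeStat_le`, which is the special case of a globally
bounded `g`).  Size S–M.  Leans on: tree `tubeStat`, `abs_tubeStat_le` (pattern), `integral_empiricalMeasure`,
`continuous_euclidDist(_apply)`, `continuous_localMaxwellian`, `Torus.measurable_geometry_sepVec`,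
`Torus.continuous_geometry_translate`; Mathlib `Measurable.ite`, `Finset.measurable_sum`, `measurableSet_lt/le`,
`Real.measurable_log`, `IsCompact.exists_bound_of_continuousOn`, `CompactSpace (UnitAddTorus _)`. -/
def Stubs.stub_tubeStatRegular : Prop :=
    ∀ (σ : ℝ) (N : ℕ) (χ : ℝ × UnitAddTorus (Fin 3) → ℝ) (g : ℝ → ℝ)
      (Ψ : EuclideanSpace ℝ (Fin 3) × EuclideanSpace ℝ (Fin 3) × EuclideanSpace ℝ (Fin 3) → ℝ)
      (r ϑ L κ τ : ℝ),
      Continuous χ → Continuous g → Continuous Ψ → (∃ C : ℝ, ∀ q, |Ψ q| ≤ C) → 0 < r → 0 ≤ L → 0 ≤ κ →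
      Measurable (fun p : ℝ × Config (N + 1) (Fin 3) T3 => tubeStat σ N χ g Ψ r ϑ L κ p.1 p.2) ∧
      ∃ B : ℝ, ∀ t ∈ Set.Icc (0 : ℝ) τ, ∀ z : Config (N + 1) (Fin 3) T3, |tubeStat σ N χ g Ψ r ϑ L κ t z| ≤ B

/-- Registered stub S6 (`Stubs.stub_tubeStatRegular`, verbatim): CLOSED — proved in the tree by worker S6 (p74720). [folklore] -/
theorem stub_tubeStatRegular :
    ∀ (σ : ℝ) (N : ℕ) (χ : ℝ × UnitAddTorus (Fin 3) → ℝ) (g : ℝ → ℝ)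
      (Ψ : EuclideanSpace ℝ (Fin 3) × EuclideanSpace ℝ (Fin 3) × EuclideanSpace ℝ (Fin 3) → ℝ)
      (r ϑ L κ τ : ℝ),
      Continuous χ → Continuous g → Continuous Ψ → (∃ C : ℝ, ∀ q, |Ψ q| ≤ C) → 0 < r → 0 ≤ L → 0 ≤ κ →
      Measurable (fun p : ℝ × Config (N + 1) (Fin 3) T3 => tubeStat σ N χ g Ψ r ϑ L κ p.1 p.2) ∧
      ∃ B : ℝ, ∀ t ∈ Set.Icc (0 : ℝ) τ, ∀ z : Config (N + 1) (Fin 3) T3, |tubeStat σ N χ g Ψ r ϑ L κ t z| ≤ B :=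
  -- LANDED (worker S6, p74720): `Theorems/JParityClosureOddContactSymmetryTubeStatRegular.lean`
  Summit.AtomisticToContinuum.HydrodynamicLimit.Theorems.stub_tubeStatRegular


/-! ## The composition (kernel-checked, sorry-free) -/

/-- **`OddContactSymmetry` from S1–S6.**  Thresholds `η₀, σ₀, r₀` are minima of the stubs' thresholds (a cutoff `g`
vanishing on `[min, ∞)` vanishes on each `[ηᵢ, ∞)`; `σ₀ ≤ 1/2` moreover, so that the local Gibbs laws are probability
measures, `isProbabilityMeasure_localGibbsLaw`); S6 supplies the measurability and the uniform bound of the tube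
functional that S5 consumes; given `(η, δ)` the three probabilistic inputs are run at
`(η/3, δ/3)`, S3 at mean accuracy `m = η/6`, S4 at variance `ς = (δ/3)(η/6)²/τ²` so that S5 returns
`τ²ς/(η/3 − η/6)² = δ/3`; `L := max L₀ 1`, `κ := min (κ₀/2) 1`, `N₀ := max`; and
`{η < |D|} ⊆ {η/3 < |D − D_L|} ∪ {η/3 < |D_L − T|} ∪ {η/3 < |T|}` (triangle inequality) with `measure_union_le`
and `ENNReal.ofReal_add`. [folklore] -/
theorem OddContactSymmetry_of
    (hS1 : Stubs.stub_reweightingTight) (hS2 : Stubs.stub_cylinderPullback) (hS3 : Stubs.stub_meanParity)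
    (hS4 : Stubs.stub_fixedTimeVariance) (hS5 : Stubs.stub_l2ToProbability)
    (hS6 : Stubs.stub_tubeStatRegular) :
    OddContactSymmetry := by
  refine oddContactSymmetry_iff.2 ?_
  obtain ⟨η₁, hη₁, H1⟩ := hS1
  obtain ⟨η₂, hη₂, H2⟩ := hS2
  obtain ⟨η₃, hη₃, H3⟩ := hS3
  obtain ⟨η₄, hη₄, H4⟩ := hS4
  refine ⟨min (min η₁ η₂) (min η₃ η₄), lt_min (lt_min hη₁ hη₂) (lt_min hη₃ hη₄), ?_⟩
  intro a₀ θ₀ u₀ ha hθ hu ha0 hθ0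
  obtain ⟨σ₁, hσ₁, H1⟩ := H1 a₀ θ₀ u₀ ha hθ hu ha0 hθ0
  obtain ⟨σ₂, hσ₂, H2⟩ := H2 a₀ θ₀ u₀ ha hθ hu ha0 hθ0
  obtain ⟨σ₃, hσ₃, H3⟩ := H3 a₀ θ₀ u₀ ha hθ hu ha0 hθ0
  obtain ⟨σ₄, hσ₄, H4⟩ := H4 a₀ θ₀ u₀ ha hθ hu ha0 hθ0
  refine ⟨min (min (min σ₁ σ₂) (min σ₃ σ₄)) (1 / 2),
    lt_min (lt_min (lt_min hσ₁ hσ₂) (lt_min hσ₃ hσ₄)) (by norm_num), ?_⟩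
  intro σ hσ hσlt' Φ τ hτ χ hχ g hg hg0 Ψ hΨ hΨb hΨJ η δ hη hδ
  have hσlt : σ < min (min σ₁ σ₂) (min σ₃ σ₄) := lt_of_lt_of_le hσlt' (min_le_left _ _)
  have hσhalf : σ ≤ 1 / 2 := (lt_of_lt_of_le hσlt' (min_le_right _ _)).le
  have hσ1 : σ < σ₁ := lt_of_lt_of_le hσlt ((min_le_left _ _).trans (min_le_left _ _))
  have hσ2 : σ < σ₂ := lt_of_lt_of_le hσlt ((min_le_left _ _).trans (min_le_right _ _))
  have hσ3 : σ < σ₃ := lt_of_lt_of_le hσlt ((min_le_right _ _).trans (min_le_left _ _))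
  have hσ4 : σ < σ₄ := lt_of_lt_of_le hσlt ((min_le_right _ _).trans (min_le_right _ _))
  have hg1 : ∀ a, η₁ ≤ a → g a = 0 := fun a h => hg0 a (((min_le_left _ _).trans (min_le_left _ _)).trans h)
  have hg2 : ∀ a, η₂ ≤ a → g a = 0 := fun a h => hg0 a (((min_le_left _ _).trans (min_le_right _ _)).trans h)
  have hg3 : ∀ a, η₃ ≤ a → g a = 0 := fun a h => hg0 a (((min_le_right _ _).trans (min_le_left _ _)).trans h)
  have hg4 : ∀ a, η₄ ≤ a → g a = 0 := fun a h => hg0 a (((min_le_right _ _).trans (min_le_right _ _)).trans h)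
  -- accuracies
  have hη3 : 0 < η / 3 := by positivity
  have hδ3 : 0 < δ / 3 := by positivity
  have hη6 : 0 < η / 6 := by positivity
  have hς : 0 < δ / 3 * (η / 6) ^ 2 / τ ^ 2 := by positivity
  obtain ⟨r₁, hr₁, H1⟩ := H1 σ hσ hσ1 Φ τ hτ χ hχ g hg hg1 Ψ hΨ hΨb (η / 3) (δ / 3) hη3 hδ3
  obtain ⟨r₂, hr₂, H2⟩ := H2 σ hσ hσ2 Φ τ hτ χ hχ g hg hg2 Ψ hΨ hΨb (η / 3) (δ / 3) hη3 hδ3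
  obtain ⟨r₃, hr₃, H3⟩ := H3 σ hσ hσ3 Φ τ hτ χ hχ g hg hg3 Ψ hΨ hΨb hΨJ (η / 6) hη6
  obtain ⟨r₄, hr₄, H4⟩ := H4 σ hσ hσ4 Φ τ hτ χ hχ g hg hg4 Ψ hΨ hΨb (δ / 3 * (η / 6) ^ 2 / τ ^ 2) hς
  refine ⟨min (min r₁ r₂) (min r₃ r₄), lt_min (lt_min hr₁ hr₂) (lt_min hr₃ hr₄), ?_⟩
  intro r ϑ hr hrlt hϑ hϑlt
  have hr1 : r < r₁ := lt_of_lt_of_le hrlt ((min_le_left _ _).trans (min_le_left _ _))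
  have hr2 : r < r₂ := lt_of_lt_of_le hrlt ((min_le_left _ _).trans (min_le_right _ _))
  have hr3 : r < r₃ := lt_of_lt_of_le hrlt ((min_le_right _ _).trans (min_le_left _ _))
  have hr4 : r < r₄ := lt_of_lt_of_le hrlt ((min_le_right _ _).trans (min_le_right _ _))
  have hϑ1 : ϑ < r₁ := lt_of_lt_of_le hϑlt ((min_le_left _ _).trans (min_le_left _ _))
  have hϑ2 : ϑ < r₂ := lt_of_lt_of_le hϑlt ((min_le_left _ _).trans (min_le_right _ _))
  have hϑ3 : ϑ < r₃ := lt_of_lt_of_le hϑlt ((min_le_right _ _).trans (min_le_left _ _))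
  have hϑ4 : ϑ < r₄ := lt_of_lt_of_le hϑlt ((min_le_right _ _).trans (min_le_right _ _))
  -- truncation level
  obtain ⟨L₀, H1⟩ := H1 r ϑ hr hr1 hϑ hϑ1
  have hL₀ : L₀ ≤ max L₀ 1 := le_max_left _ _
  have hL1 : (1 : ℝ) ≤ max L₀ 1 := le_max_right _ _
  have hLpos : (0 : ℝ) < max L₀ 1 := lt_of_lt_of_le one_pos hL1
  obtain ⟨N₁, H1⟩ := H1 (max L₀ 1) hL₀
  -- flight-time window
  obtain ⟨κ₀, hκ₀, H2⟩ := H2 r ϑ hr hr2 hϑ hϑ2 (max L₀ 1) hL1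
  have hκpos : (0 : ℝ) < min (κ₀ / 2) 1 := lt_min (by positivity) one_pos
  have hκlt : min (κ₀ / 2) 1 < κ₀ := lt_of_le_of_lt (min_le_left _ _) (by linarith)
  have hκ1 : min (κ₀ / 2) 1 ≤ (1 : ℝ) := min_le_right _ _
  obtain ⟨N₂, H2⟩ := H2 (min (κ₀ / 2) 1) hκpos hκlt
  obtain ⟨N₃, H3⟩ := H3 r ϑ hr hr3 hϑ hϑ3 (max L₀ 1) (min (κ₀ / 2) 1) hL1 hκpos hκ1
  obtain ⟨N₄, H4⟩ := H4 r ϑ hr hr4 hϑ hϑ4 (max L₀ 1) (min (κ₀ / 2) 1) hL1 hκpos hκ1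
  refine ⟨max (max N₁ N₂) (max N₃ N₄), fun N hN => ?_⟩
  have hN1 : N₁ ≤ N := ((le_max_left _ _).trans (le_max_left _ _)).trans hN
  have hN2 : N₂ ≤ N := ((le_max_right _ _).trans (le_max_left _ _)).trans hN
  have hN3 : N₃ ≤ N := ((le_max_left _ _).trans (le_max_right _ _)).trans hN
  have hN4 : N₄ ≤ N := ((le_max_right _ _).trans (le_max_right _ _)).trans hN
  have E1 := H1 N hN1
  have E2 := H2 N hN2
  have E3 := H3 N hN3
  have E4 := H4 N hN4
  -- regularity of the tube functional (S6) and the probability law, fed into S5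
  obtain ⟨hmeas, B, hB⟩ := hS6 σ N χ g Ψ r ϑ (max L₀ 1) (min (κ₀ / 2) 1) τ hχ hg hΨ hΨb hr hLpos.le hκpos.le
  have hPN : IsProbabilityMeasure (localGibbsLaw σ a₀ u₀ θ₀ N (Φ N)) :=
    isProbabilityMeasure_localGibbsLaw ha hθ hu ha0 hθ0 hσhalf N (Φ N)
  have E5 := hS5 σ a₀ θ₀ u₀ N (Φ N) τ χ g Ψ r ϑ (max L₀ 1) (min (κ₀ / 2) 1) (η / 6)
    (δ / 3 * (η / 6) ^ 2 / τ ^ 2) (η / 3) B hPN hmeas hB hτ hς.le (by linarith) E3 E4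
  have hval : τ ^ 2 * (δ / 3 * (η / 6) ^ 2 / τ ^ 2) / (η / 3 - η / 6) ^ 2 = δ / 3 := by
    field_simp
    ring
  rw [hval] at E5
  -- the union bound
  set P := localGibbsLaw σ a₀ u₀ θ₀ N (Φ N) with hP
  set D := fun z => oddStat σ N (Φ N) τ χ g Ψ r ϑ z with hD
  set DL := fun z => oddStatTrunc σ N (Φ N) τ χ g Ψ r ϑ (max L₀ 1) z with hDL
  set T := fun z => tubeTimeStat σ N (Φ N) τ χ g Ψ r ϑ (max L₀ 1) (min (κ₀ / 2) 1) z with hT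
  have hsub : {z | η < |D z|} ⊆
      ({z | η / 3 < |D z - DL z|} ∪ {z | η / 3 < |DL z - T z|}) ∪ {z | η / 3 < |T z|} := by
    intro z hz
    simp only [Set.mem_setOf_eq, Set.mem_union] at hz ⊢
    by_contra hcon
    simp only [not_or, not_lt] at hcon
    obtain ⟨⟨h1, h2⟩, h3⟩ := hcon
    have i1 := abs_sub_abs_le_abs_sub (D z) (DL z)
    have i2 := abs_sub_abs_le_abs_sub (DL z) (T z)
    linarith
  calc P {z | η < |D z|}
      ≤ P (({z | η / 3 < |D z - DL z|} ∪ {z | η / 3 < |DL z - T z|}) ∪ {z | η / 3 < |T z|}) :=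
        measure_mono hsub
    _ ≤ P ({z | η / 3 < |D z - DL z|} ∪ {z | η / 3 < |DL z - T z|}) + P {z | η / 3 < |T z|} :=
        measure_union_le _ _
    _ ≤ (P {z | η / 3 < |D z - DL z|} + P {z | η / 3 < |DL z - T z|}) + P {z | η / 3 < |T z|} :=
        add_le_add (measure_union_le _ _) le_rfl
    _ ≤ (ENNReal.ofReal (δ / 3) + ENNReal.ofReal (δ / 3)) + ENNReal.ofReal (δ / 3) :=
        add_le_add (add_le_add E1 E2) E5
    _ = ENNReal.ofReal δ := by
        rw [← ENNReal.ofReal_add hδ3.le hδ3.le, ← ENNReal.ofReal_add (by positivity) hδ3.le]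
        congr 1
        ring

/-- **The skeleton IS the crux proof modulo the registered stubs** (D-0027 §3.3 shape
`theorem <Crux>_proof : <crux decl> := <line>._of stub₁ … stubₖ`): sorry-free itself; its only gaps are the six
`stub_*` theorems above, matched by `OddContactSymmetry_of` against the statement `Prop`s `Stubs.stub_*` by `rfl`-unfolding.
[folklore] -/
theorem OddContactSymmetry_proof : OddContactSymmetry :=
  OddContactSymmetry_of stub_reweightingTight stub_cylinderPullback stub_meanParity stub_fixedTimeVariance
    stub_l2ToProbability stub_tubeStatRegular

end

end Summit.AtomisticToContinuum.HydrodynamicLimit.Cruxes.OddContactSymmetry.EquilibriumRungMeanVariance
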